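import Literature.MathematicalPhysics.KineticTheory.TaggedSphereDiffusionCorrector
import HarnessLib

/-!
# The spectral gap of the hard-sphere linear Boltzmann operator and the isotropy of the
# diffusion matrix
(Bodineau–Gallagher–Saint-Raymond, Invent. Math. 203 (2016) = arXiv:1305.3397v2, §6.1.2,
Lemma 6.1, (6.5), (6.8); a layer of the proof of the hydrodynamic limit (6.3),
`Literature.MathematicalPhysics.KineticTheory.bgsr_hydrodynamicLimit` of `TaggedSphereDiffusion`)

BGSR's Lemma 6.1 (`L = a_β (Id - T)` is Fredholm on `L²(a_β M_β)` with kernel the constants,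
proved in `TaggedSphereDiffusionCorrector` from the compactness of `T = a_β⁻¹ K`,
`TaggedSphereGainCompact`) has two quantitative consequences used in the diffusive limit of the
linear Boltzmann equation (BGSR §6.1.3, there hidden in "the maximum principle" and in "an easy
computation shows that `ρ̃₀ = ρ` where `∂_τ ρ - κ_β Δ ρ = 0`"):

* **Part I, the spectral gap** (`exists_spectralGap`): there is `c₀ > 0` with
  `⟨L g, g⟩_{L²(M_β)} ≥ c₀ ‖g - ⟨g⟩‖²_{L²(a_β M_β)}` for every `g` of finite energy, `⟨g⟩` its
  `a_β M_β`-mean. Proof: by the Fredholm alternative `Id - (T - P)` is invertible (`P` the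
  rank-one projection on the constants, `TaggedSphereDiffusionCorrector.not_hasEigenvalue_one`),
  so `‖h‖ ≤ C ‖h - T h‖` on `1^⊥`; and for the nonnegative symmetric form
  `p(x, y) = ⟪x - T x, y⟫` the Cauchy–Schwarz inequality gives `‖x - T x‖² ≤ 2 p(x, x)`.
* **Part II, isotropy of the diffusion matrix** (`IsDiffusionCorrector.integral_coord_mul_coord_of_ne`,
  `IsDiffusionCorrector.integral_coord_mul_coord_self`, `IsDiffusionCorrector.integral_inner_mul_inner`):
  for the corrector `b = L⁻¹ v` of (6.5), `∫ vᵢ bⱼ(v) M_β(v) dv = κ_β δᵢⱼ` with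
  `κ_β = d⁻¹ ∫ v · b M_β` the coefficient (6.8), hence `∫ (k·v)(k·b(v)) M_β = κ_β |k|²`.
  BGSR obtain this from the radial symmetry `b(v) = γ(|v|) v`; we use less: `L` commutes with
  linear isometries of `ℝ^d` (`carlemanGain_comp_isometry`), so `Q⁻¹ ∘ b ∘ Q` is again a
  corrector (`IsDiffusionCorrector.comp_isometry`) and equals `b` a.e. by uniqueness
  (`isDiffusionCorrector_unique`); taking for `Q` the coordinate sign flips and transpositions
  forces the matrix `(∫ vᵢ bⱼ M_β)ᵢⱼ` to be scalar.

## References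

* T. Bodineau, I. Gallagher, L. Saint-Raymond, *The Brownian motion as the limit of a
  deterministic system of hard-spheres*, Invent. Math. 203 (2016) 493–553 = arXiv:1305.3397v2,
  §6.1.2: Lemma 6.1, (6.5), (6.8).
* C. Cercignani, R. Illner, M. Pulvirenti, *The Mathematical Theory of Dilute Gases* (1994), §7.2.
-/

open MeasureTheory Metric Set Filter Topology ProbabilityTheory
open scoped InnerProductSpace ENNReal NNReal

noncomputable section

namespace Literature.MathematicalPhysics.KineticTheory

open Literature.Analysis.FunctionSpaces (maxwellianBeta maxwellianBeta_pos)
open TaggedSphereDiffusion (collisionFrequency)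

variable {d : Type*} [Fintype d] {β : ℝ}

/-! # Part I. The spectral gap -/

/-! ## The nonnegative symmetric form `p(x, y) = ⟪x - T x, y⟫` on `L²(a_β M_β)` -/

section Form

variable (hd : 2 ≤ Fintype.card d) (hβ : 0 < β)

include hβ in
/-- `T` is symmetric: `⟪T g, h⟫ = ⟪g, T h⟫` (detailed balance, `carlemanForm_comm`). [folklore] -/
theorem inner_gainOp_comm (g h : Lp ℝ 2 (energyMeasure (d := d) β)) :
    ⟪gainOp hd hβ g, h⟫_ℝ = ⟪g, gainOp hd hβ h⟫_ℝ := by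
  rw [inner_gainOp, real_inner_comm, inner_gainOp, carlemanForm_comm hβ]

include hd hβ in
/-- `⟪g - T g, g⟫ = ‖g‖² - ⟪T g, g⟫ ≥ 0` (the Dirichlet form of `Id - T`). [folklore] -/
theorem norm_sq_sub_inner_gainOp_nonneg (g : Lp ℝ 2 (energyMeasure (d := d) β)) :
    0 ≤ ‖g‖ ^ 2 - ⟪gainOp hd hβ g, g⟫_ℝ := by
  have h := two_mul_norm_sq_sub_inner_gainOp hd hβ g
  have hnn : 0 ≤ ∫ z, maxwellianBeta β z.1 * carlemanKernel β z.1 z.2 * (rep g z.1 - rep g (z.1 + z.2)) ^ 2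
      ∂((volume : Measure (EuclideanSpace ℝ d)).prod volume) :=
    integral_nonneg fun z => mul_nonneg (carlemanWeight_nonneg hβ z) (sq_nonneg _)
  linarith

/-- The form `p(x, y) = ⟪x - T x, y⟫`. [folklore] -/
def gapForm (x y : Lp ℝ 2 (energyMeasure (d := d) β)) : ℝ := ⟪x - gainOp hd hβ x, y⟫_ℝ

/-- `p(x, x) = ‖x‖² - ⟪T x, x⟫`. [folklore] -/
theorem gapForm_self (x : Lp ℝ 2 (energyMeasure (d := d) β)) :
    gapForm hd hβ x x = ‖x‖ ^ 2 - ⟪gainOp hd hβ x, x⟫_ℝ := by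
  rw [gapForm, inner_sub_left, real_inner_self_eq_norm_sq]

include hd hβ in
/-- `p(x, x) ≥ 0`. [folklore] -/
theorem gapForm_self_nonneg (x : Lp ℝ 2 (energyMeasure (d := d) β)) : 0 ≤ gapForm hd hβ x x := by
  rw [gapForm_self]; exact norm_sq_sub_inner_gainOp_nonneg hd hβ x

/-- `p` is symmetric (because `T` is). [folklore] -/
theorem gapForm_comm (x y : Lp ℝ 2 (energyMeasure (d := d) β)) :
    gapForm hd hβ x y = gapForm hd hβ y x := by
  rw [gapForm, gapForm, inner_sub_left, inner_sub_left, inner_gainOp_comm hd hβ, real_inner_comm x y,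
    real_inner_comm (gainOp hd hβ y) x]

/-- `p` is additive in the first slot. [folklore] -/
theorem gapForm_add_left (x x' y : Lp ℝ 2 (energyMeasure (d := d) β)) :
    gapForm hd hβ (x + x') y = gapForm hd hβ x y + gapForm hd hβ x' y := by
  simp only [gapForm, map_add, add_sub_add_comm, inner_add_left]

/-- `p` is homogeneous in the first slot. [folklore] -/
theorem gapForm_smul_left (c : ℝ) (x y : Lp ℝ 2 (energyMeasure (d := d) β)) :
    gapForm hd hβ (c • x) y = c * gapForm hd hβ x y := by
  simp only [gapForm, map_smul, ← smul_sub, inner_smul_left, conj_trivial]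

/-- `p` is additive in the second slot. [folklore] -/
theorem gapForm_add_right (x y y' : Lp ℝ 2 (energyMeasure (d := d) β)) :
    gapForm hd hβ x (y + y') = gapForm hd hβ x y + gapForm hd hβ x y' := by
  rw [gapForm_comm, gapForm_add_left, gapForm_comm hd hβ y, gapForm_comm hd hβ y']

/-- `p` is homogeneous in the second slot. [folklore] -/
theorem gapForm_smul_right (c : ℝ) (x y : Lp ℝ 2 (energyMeasure (d := d) β)) :
    gapForm hd hβ x (c • y) = c * gapForm hd hβ x y := by
  rw [gapForm_comm, gapForm_smul_left, gapForm_comm]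

include hd hβ in
/-- **Cauchy–Schwarz for the Dirichlet form of `Id - T`**: `p(x, y)² ≤ p(x, x) p(y, y)`
(discriminant of `t ↦ p(x + t y, x + t y) ≥ 0`). [folklore] -/
theorem gapForm_sq_le (x y : Lp ℝ 2 (energyMeasure (d := d) β)) :
    gapForm hd hβ x y ^ 2 ≤ gapForm hd hβ x x * gapForm hd hβ y y := by
  have hquad : ∀ t : ℝ, 0 ≤ gapForm hd hβ y y * (t * t) + 2 * gapForm hd hβ x y * t + gapForm hd hβ x x := by
    intro t
    have h := gapForm_self_nonneg hd hβ (x + t • y)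
    have hexp : gapForm hd hβ (x + t • y) (x + t • y) =
        gapForm hd hβ y y * (t * t) + 2 * gapForm hd hβ x y * t + gapForm hd hβ x x := by
      simp only [gapForm_add_left, gapForm_add_right, gapForm_smul_left, gapForm_smul_right,
        gapForm_comm hd hβ y x]
      ring
    rw [hexp] at h
    exact h
  have hdisc := discrim_le_zero hquad
  rw [discrim] at hdisc
  nlinarith [hdisc]

include hd hβ in
/-- **`‖x - T x‖² ≤ 2 ⟪x - T x, x⟫`** (Cauchy–Schwarz with `y = x - T x` and `‖Id - T‖ ≤ 2`).
[folklore] -/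
theorem norm_sub_gainOp_sq_le (x : Lp ℝ 2 (energyMeasure (d := d) β)) :
    ‖x - gainOp hd hβ x‖ ^ 2 ≤ 2 * (‖x‖ ^ 2 - ⟪gainOp hd hβ x, x⟫_ℝ) := by
  set y := x - gainOp hd hβ x with hy
  have hpxy : gapForm hd hβ x y = ‖y‖ ^ 2 := by
    rw [gapForm, ← hy, real_inner_self_eq_norm_sq]
  -- `p(y, y) ≤ 2 ‖y‖²`
  have hpyy : gapForm hd hβ y y ≤ 2 * ‖y‖ ^ 2 := by
    rw [gapForm_self]
    have h1 : |⟪gainOp hd hβ y, y⟫_ℝ| ≤ ‖gainOp hd hβ y‖ * ‖y‖ := abs_real_inner_le_norm _ _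
    have h2 : ‖gainOp hd hβ y‖ ≤ 1 * ‖y‖ :=
      (gainOp hd hβ).le_of_opNorm_le (norm_gainOp_le_one hd hβ) y
    have h3 : -⟪gainOp hd hβ y, y⟫_ℝ ≤ ‖y‖ * ‖y‖ := by
      have := neg_abs_le ⟪gainOp hd hβ y, y⟫_ℝ
      nlinarith [norm_nonneg y]
    nlinarith
  have hcs := gapForm_sq_le hd hβ x y
  rw [hpxy, ← gapForm_self] at *
  -- `‖y‖⁴ ≤ p(x,x) · 2 ‖y‖²`
  by_cases h0 : ‖y‖ = 0
  · rw [h0]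
    simpa using mul_nonneg zero_le_two (gapForm_self_nonneg hd hβ x)
  · have hpos : 0 < ‖y‖ ^ 2 := by positivity
    have h4 : (‖y‖ ^ 2) ^ 2 ≤ gapForm hd hβ x x * (2 * ‖y‖ ^ 2) :=
      hcs.trans (mul_le_mul_of_nonneg_left hpyy (gapForm_self_nonneg hd hβ x))
    nlinarith

end Form

/-! ## Invertibility of `Id - (T - P)` and the gap on `L²(a_β M_β)` -/

section GapLp

variable (hd : 2 ≤ Fintype.card d) (hβ : 0 < β)

include hd hβ in
/-- **A resolvent bound on `1^⊥`**: there is `C ≥ 0` with `‖h‖ ≤ C ‖h - T h‖` whenever `⟪1, h⟫ = 0`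
(the Fredholm alternative for the compact `T - P`: `1` is not an eigenvalue, so `Id - (T - P)`
has a bounded inverse, and `(T - P) h = T h` on `1^⊥`). [cite: BodineauGallagherSaintRaymondInvent2016, Lemma 6.1] -/
theorem exists_norm_le_mul_norm_sub_gainOp :
    ∃ C : ℝ, 0 ≤ C ∧ ∀ h : Lp ℝ 2 (energyMeasure (d := d) β), ⟪constOne hβ, h⟫_ℝ = 0 →
      ‖h‖ ≤ C * ‖h - gainOp hd hβ h‖ := by
  set T' := gainOp hd hβ - projConst hβ with hT'
  have hcomp : IsCompactOperator T' := (isCompactOperator_gainOp hd hβ).sub (isCompactOperator_projConst hβ)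
  have hres := (IsCompactOperator.hasEigenvalue_or_mem_resolventSet hcomp one_ne_zero).resolve_left
    (not_hasEigenvalue_one hd hβ)
  rw [spectrum.mem_resolventSet_iff] at hres
  obtain ⟨u, hu⟩ := hres
  refine ⟨‖((u⁻¹ : (Lp ℝ 2 (energyMeasure (d := d) β) →L[ℝ] Lp ℝ 2 (energyMeasure (d := d) β))ˣ) :
      Lp ℝ 2 (energyMeasure (d := d) β) →L[ℝ] Lp ℝ 2 (energyMeasure (d := d) β))‖, norm_nonneg _,
    fun h hh => ?_⟩
  have hP : projConst hβ h = 0 := by rw [projConst_apply, hh, zero_smul]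
  have hUh : (u : Lp ℝ 2 (energyMeasure (d := d) β) →L[ℝ] Lp ℝ 2 (energyMeasure (d := d) β)) h =
      h - gainOp hd hβ h := by
    rw [hu]
    change (algebraMap ℝ _ (1 : ℝ) - T') h = _
    rw [Algebra.algebraMap_eq_smul_one, one_smul, _root_.sub_apply,
      one_apply_eq_self, hT', _root_.sub_apply, hP, sub_zero]
  have hinv : ((u⁻¹ : (Lp ℝ 2 (energyMeasure (d := d) β) →L[ℝ] Lp ℝ 2 (energyMeasure (d := d) β))ˣ) :
      Lp ℝ 2 (energyMeasure (d := d) β) →L[ℝ] Lp ℝ 2 (energyMeasure (d := d) β))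
        ((u : Lp ℝ 2 (energyMeasure (d := d) β) →L[ℝ] Lp ℝ 2 (energyMeasure (d := d) β)) h) = h := by
    rw [← mul_apply_eq_comp, Units.inv_mul, one_apply_eq_self]
  calc ‖h‖ = ‖((u⁻¹ : (Lp ℝ 2 (energyMeasure (d := d) β) →L[ℝ] Lp ℝ 2 (energyMeasure (d := d) β))ˣ) :
        Lp ℝ 2 (energyMeasure (d := d) β) →L[ℝ] Lp ℝ 2 (energyMeasure (d := d) β))
          ((u : Lp ℝ 2 (energyMeasure (d := d) β) →L[ℝ] Lp ℝ 2 (energyMeasure (d := d) β)) h)‖ := by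
        rw [hinv]
    _ ≤ _ * ‖(u : Lp ℝ 2 (energyMeasure (d := d) β) →L[ℝ] Lp ℝ 2 (energyMeasure (d := d) β)) h‖ :=
        ContinuousLinearMap.le_opNorm _ _
    _ = _ := by rw [hUh]

include hd in
/-- `⟪1, g - P g⟫ = 0`. [folklore] -/
theorem inner_constOne_sub_projConst (g : Lp ℝ 2 (energyMeasure (d := d) β)) :
    ⟪constOne hβ, g - projConst hβ g⟫_ℝ = 0 := by
  rw [inner_sub_right, real_inner_comm (projConst hβ g) (constOne hβ), inner_projConst_constOne hd hβ, sub_self]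

include hd in
/-- The Dirichlet form does not see constants: `p(g - P g, g - P g) = p(g, g)`. [folklore] -/
theorem gapForm_sub_projConst (g : Lp ℝ 2 (energyMeasure (d := d) β)) :
    gapForm hd hβ (g - projConst hβ g) (g - projConst hβ g) = gapForm hd hβ g g := by
  -- `p(x, c • 1) = 0` for every `x`
  have hx1 : ∀ x : Lp ℝ 2 (energyMeasure (d := d) β), gapForm hd hβ x (projConst hβ g) = 0 := by
    intro x
    rw [gapForm, projConst_apply, inner_smul_right, inner_smul_right, inner_sub_left,
      inner_gainOp_constOne hd hβ, sub_self, mul_zero, mul_zero]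
  have h1 : gapForm hd hβ (g - projConst hβ g) (g - projConst hβ g) =
      gapForm hd hβ (g - projConst hβ g) g - gapForm hd hβ (g - projConst hβ g) (projConst hβ g) := by
    rw [gapForm, gapForm, gapForm, inner_sub_right]
  rw [h1, hx1, sub_zero, sub_eq_add_neg, ← neg_one_smul ℝ (projConst hβ g),
    gapForm_add_left, gapForm_smul_left, gapForm_comm hd hβ (projConst hβ g) g, hx1]
  ring

include hd hβ in
/-- **The spectral gap on `L²(a_β M_β)`**: there is `c₀ > 0` with
`c₀ ‖g - P g‖² ≤ ‖g‖² - ⟪T g, g⟫ = ⟪(Id - T) g, g⟫` for all `g`.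
[cite: BodineauGallagherSaintRaymondInvent2016, Lemma 6.1] -/
theorem exists_gap_Lp :
    ∃ c₀ : ℝ, 0 < c₀ ∧ ∀ g : Lp ℝ 2 (energyMeasure (d := d) β),
      c₀ * ‖g - projConst hβ g‖ ^ 2 ≤ ‖g‖ ^ 2 - ⟪gainOp hd hβ g, g⟫_ℝ := by
  obtain ⟨C, hC0, hC⟩ := exists_norm_le_mul_norm_sub_gainOp hd hβ
  refine ⟨(2 * C ^ 2 + 1)⁻¹, by positivity, fun g => ?_⟩
  set h := g - projConst hβ g with hh
  have h1 : ‖h‖ ≤ C * ‖h - gainOp hd hβ h‖ := hC h (inner_constOne_sub_projConst hd hβ g)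
  have h2 : ‖h - gainOp hd hβ h‖ ^ 2 ≤ 2 * (‖h‖ ^ 2 - ⟪gainOp hd hβ h, h⟫_ℝ) := norm_sub_gainOp_sq_le hd hβ h
  have h3 : ‖h‖ ^ 2 - ⟪gainOp hd hβ h, h⟫_ℝ = ‖g‖ ^ 2 - ⟪gainOp hd hβ g, g⟫_ℝ := by
    rw [← gapForm_self, ← gapForm_self, hh, gapForm_sub_projConst hd hβ g]
  have hp : 0 ≤ ‖g‖ ^ 2 - ⟪gainOp hd hβ g, g⟫_ℝ := norm_sq_sub_inner_gainOp_nonneg hd hβ g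
  rw [h3] at h2
  have h4 : ‖h‖ ^ 2 ≤ C ^ 2 * ‖h - gainOp hd hβ h‖ ^ 2 := by
    rw [← mul_pow]; exact pow_le_pow_left₀ (norm_nonneg _) h1 2
  have h5 : ‖h‖ ^ 2 ≤ (2 * C ^ 2 + 1) * (‖g‖ ^ 2 - ⟪gainOp hd hβ g, g⟫_ℝ) := by nlinarith
  rw [inv_mul_le_iff₀ (by positivity)]
  exact h5

end GapLp

/-! ## The gap for functions of finite energy -/

section GapConcrete

variable (hd : 2 ≤ Fintype.card d) (hβ : 0 < β)

/-- The Dirichlet form of `L` on functions of finite energy: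
`B(g, h) = ∫ g h a_β M_β - ∫∫ M_β k_β g(v + u) h(v) = ⟨a_β g - K g, h⟩_{L²(M_β)} = ⟨L g, h⟩_{L²(M_β)}`.
[cite: BodineauGallagherSaintRaymondInvent2016, §6.1.2] -/
def dirichletForm (β : ℝ) (g h : EuclideanSpace ℝ d → ℝ) : ℝ :=
  (∫ v, g v * h v * (collisionFrequency β v * maxwellianBeta β v)) - carlemanForm β g h

/-- The `a_β M_β`-mean of `g`: `⟨g⟩ = ∫ g a_β M_β / ∫ a_β M_β`. [folklore] -/
def energyMean (β : ℝ) (g : EuclideanSpace ℝ d → ℝ) : ℝ :=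
  (∫ v, g v * (collisionFrequency β v * maxwellianBeta β v)) /
    ∫ v : EuclideanSpace ℝ d, collisionFrequency β v * maxwellianBeta β v

include hβ in
/-- A function of finite energy is in `L²(a_β M_β)`. [folklore] -/
theorem FiniteEnergy.memLp {g : EuclideanSpace ℝ d → ℝ} (hg : FiniteEnergy β g) :
    MemLp g 2 (energyMeasure (d := d) β) := by
  rw [memLp_two_iff_integrable_sq hg.measurable.aestronglyMeasurable, integrable_energyMeasure_iff hβ]
  exact hg.integrable.congr (Eventually.of_forall fun v => by ring)

include hd hβ in
/-- `‖toLp g‖² = ∫ g² a M`. [folklore] -/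
theorem norm_toLp_sq_eq {g : EuclideanSpace ℝ d → ℝ} (hg : FiniteEnergy β g) :
    ‖(hg.memLp hβ).toLp g‖ ^ 2 = ∫ v, g v ^ 2 * (collisionFrequency β v * maxwellianBeta β v) := by
  rw [norm_sq_eq_integral_rep hβ]
  refine integral_congr_ae ?_
  filter_upwards [rep_toLp_ae_eq hd hβ (hg.memLp hβ)] with v hv
  rw [hv]; ring

include hd hβ in
/-- `⟪T (toLp g), toLp g⟫ = Q_β(g, g)`. [folklore] -/
theorem inner_gainOp_toLp_eq {g : EuclideanSpace ℝ d → ℝ} (hg : FiniteEnergy β g) :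
    ⟪gainOp hd hβ ((hg.memLp hβ).toLp g), (hg.memLp hβ).toLp g⟫_ℝ = carlemanForm β g g := by
  rw [inner_gainOp, ← truncForm_one, ← truncForm_one]
  exact truncForm_congr_ae β _ (rep_toLp_ae_eq hd hβ (hg.memLp hβ)) (rep_toLp_ae_eq hd hβ (hg.memLp hβ))

include hd hβ in
/-- `⟪1, toLp g⟫ = ∫ g a M`. [folklore] -/
theorem inner_constOne_toLp_eq {g : EuclideanSpace ℝ d → ℝ} (hg : FiniteEnergy β g) :
    ⟪constOne hβ, (hg.memLp hβ).toLp g⟫_ℝ = ∫ v, g v * (collisionFrequency β v * maxwellianBeta β v) := by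
  rw [inner_constOne_left hd hβ]
  refine integral_congr_ae ?_
  filter_upwards [rep_toLp_ae_eq hd hβ (hg.memLp hβ)] with v hv
  rw [hv]

include hd hβ in
/-- `⟪1, 1⟫ = ∫ a M`. [folklore] -/
theorem inner_constOne_constOne_eq :
    ⟪constOne (d := d) hβ, constOne hβ⟫_ℝ = ∫ v : EuclideanSpace ℝ d, collisionFrequency β v * maxwellianBeta β v := by
  rw [inner_constOne hd hβ]
  refine integral_congr_ae ?_
  filter_upwards [rep_constOne hd hβ] with v hv
  rw [hv, one_mul]

include hd hβ in
/-- `‖toLp g - P (toLp g)‖² = ∫ (g - ⟨g⟩)² a M`. [folklore] -/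
theorem norm_sub_projConst_toLp_sq_eq {g : EuclideanSpace ℝ d → ℝ} (hg : FiniteEnergy β g) :
    ‖(hg.memLp hβ).toLp g - projConst hβ ((hg.memLp hβ).toLp g)‖ ^ 2 =
      ∫ v, (g v - energyMean β g) ^ 2 * (collisionFrequency β v * maxwellianBeta β v) := by
  set G : Lp ℝ 2 (energyMeasure (d := d) β) := (hg.memLp hβ).toLp g with hG
  set m := energyMean β g with hm_def
  have hm : projConst hβ G = m • constOne hβ := by
    rw [projConst_apply, smul_smul, hG, inner_constOne_toLp_eq hd hβ hg, inner_constOne_constOne_eq hd hβ, hm_def,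
      energyMean, div_eq_mul_inv]
  have hsub : G - projConst hβ G = G + (-m) • constOne hβ := by rw [hm, sub_eq_add_neg, neg_smul]
  rw [hsub, norm_sq_eq_integral_rep hβ]
  refine integral_congr_ae ?_
  filter_upwards [rep_add_ae_eq hd hβ G ((-m) • constOne hβ), rep_smul_ae_eq hd hβ (-m) (constOne hβ),
    rep_constOne hd hβ, rep_toLp_ae_eq hd hβ (hg.memLp hβ)] with v h1 h2 h3 h4
  rw [← hG] at h4
  rw [h1, Pi.add_apply, h2, Pi.smul_apply, h3, h4, smul_eq_mul]
  ring

include hd hβ in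
/-- **The spectral gap of `L`** (quantitative Lemma 6.1): there is `c₀ > 0`, depending only on
`d` and `β`, such that for every `g` of finite `a_β M_β`-energy
`c₀ ∫ (g - ⟨g⟩)² a_β M_β ≤ B(g, g) = ⟨L g, g⟩_{L²(M_β)}`, `⟨g⟩` the `a_β M_β`-mean of `g`.
[cite: BodineauGallagherSaintRaymondInvent2016, Lemma 6.1] -/
theorem exists_spectralGap :
    ∃ c₀ : ℝ, 0 < c₀ ∧ ∀ g : EuclideanSpace ℝ d → ℝ, FiniteEnergy β g →
      c₀ * ∫ v, (g v - energyMean β g) ^ 2 * (collisionFrequency β v * maxwellianBeta β v) ≤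
        dirichletForm β g g := by
  obtain ⟨c₀, hc₀, hgap⟩ := exists_gap_Lp hd hβ
  refine ⟨c₀, hc₀, fun g hg => ?_⟩
  have h := hgap ((hg.memLp hβ).toLp g)
  rw [norm_sub_projConst_toLp_sq_eq hd hβ hg, norm_toLp_sq_eq hd hβ hg, inner_gainOp_toLp_eq hd hβ hg] at h
  rw [dirichletForm]
  convert h using 3
  funext v; ring

include hd hβ in
/-- `2 B(g, g) = ∫∫ M_β(v) k_β(v, u) (g(v) - g(v + u))² du dv` for `g` of finite energy. [folklore] -/
theorem two_mul_dirichletForm_self {g : EuclideanSpace ℝ d → ℝ} (hg : FiniteEnergy β g) :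
    2 * dirichletForm β g g =
      ∫ z, maxwellianBeta β z.1 * carlemanKernel β z.1 z.2 * (g z.1 - g (z.1 + z.2)) ^ 2
        ∂((volume : Measure (EuclideanSpace ℝ d)).prod volume) := by
  have h := two_mul_norm_sq_sub_inner_gainOp hd hβ ((hg.memLp hβ).toLp g)
  rw [norm_toLp_sq_eq hd hβ hg, inner_gainOp_toLp_eq hd hβ hg] at h
  have hB : dirichletForm β g g = (∫ v, g v ^ 2 * (collisionFrequency β v * maxwellianBeta β v)) - carlemanForm β g g := by
    rw [dirichletForm]; congr 1
    refine integral_congr_ae (Eventually.of_forall fun v => ?_); ring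
  rw [hB, h]
  have hrep := rep_toLp_ae_eq hd hβ (hg.memLp hβ)
  refine integral_congr_ae ?_
  have h1 : (fun z : EuclideanSpace ℝ d × EuclideanSpace ℝ d => rep ((hg.memLp hβ).toLp g) (z.1 + z.2)) =ᵐ[volume.prod volume]
      fun z => g (z.1 + z.2) := quasiMeasurePreserving_add_euclidean.ae_eq hrep
  have h2 : (fun z : EuclideanSpace ℝ d × EuclideanSpace ℝ d => rep ((hg.memLp hβ).toLp g) z.1) =ᵐ[volume.prod volume]
      fun z => g z.1 := Measure.quasiMeasurePreserving_fst.ae_eq hrep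
  filter_upwards [h1, h2] with z hz1 hz2
  rw [hz1, hz2]

include hd hβ in
/-- `B(g, g) ≥ 0`. [folklore] -/
theorem dirichletForm_self_nonneg {g : EuclideanSpace ℝ d → ℝ} (hg : FiniteEnergy β g) :
    0 ≤ dirichletForm β g g := by
  have h := two_mul_dirichletForm_self hd hβ hg
  have hnn : 0 ≤ ∫ z, maxwellianBeta β z.1 * carlemanKernel β z.1 z.2 * (g z.1 - g (z.1 + z.2)) ^ 2
      ∂((volume : Measure (EuclideanSpace ℝ d)).prod volume) :=
    integral_nonneg fun z => mul_nonneg (carlemanWeight_nonneg hβ z) (sq_nonneg _)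
  linarith

end GapConcrete

/-! # Part II. Isotropy of the diffusion matrix -/

/-! ## `L` commutes with linear isometries -/

section Isometry

variable (Q : EuclideanSpace ℝ d ≃ₗᵢ[ℝ] EuclideanSpace ℝ d)

/-- The measurable-embedding structure of a linear isometry. [folklore] -/
theorem measurableEmbedding_isometry : MeasurableEmbedding Q :=
  Q.toContinuousLinearEquiv.toHomeomorph.measurableEmbedding

/-- `M_β` is isometry invariant. [folklore] -/
theorem maxwellianBeta_isometry (β : ℝ) (v : EuclideanSpace ℝ d) :
    maxwellianBeta β (Q v) = maxwellianBeta β v := by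
  rw [maxwellianBeta_eq, maxwellianBeta_eq, Q.norm_map]

/-- `a_β` is isometry invariant (it is a first absolute moment of `M_β(w) dw` centred at `v`). [folklore] -/
theorem collisionFrequency_isometry (hd : 2 ≤ Fintype.card d) (β : ℝ) (v : EuclideanSpace ℝ d) :
    collisionFrequency β (Q v) = collisionFrequency β v := by
  classical
  haveI : Nonempty d := Fintype.card_pos_iff.1 (by omega)
  obtain ⟨i⟩ := ‹Nonempty d›
  have he : ‖(EuclideanSpace.single i (1 : ℝ) : EuclideanSpace ℝ d)‖ = 1 := by
    rw [PiLp.norm_single, norm_one]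
  rw [collisionFrequency_eq_const_mul_integral_norm_sub he, collisionFrequency_eq_const_mul_integral_norm_sub he]
  congr 1
  rw [← (Q.measurePreserving).integral_comp (measurableEmbedding_isometry Q)]
  refine integral_congr_ae (Eventually.of_forall fun w => ?_)
  simp only
  rw [← map_sub, Q.norm_map, maxwellianBeta_isometry]

/-- The Carleman kernel is isometry invariant. [folklore] -/
theorem carlemanKernel_isometry (β : ℝ) (v u : EuclideanSpace ℝ d) :
    carlemanKernel β (Q v) (Q u) = carlemanKernel β v u := by
  simp only [carlemanKernel, Q.norm_map, Q.inner_map_map]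

/-- **`K` commutes with isometries**: `K (g ∘ Q) (v) = (K g)(Q v)`. [folklore] -/
theorem carlemanGain_comp_isometry (β : ℝ) (g : EuclideanSpace ℝ d → ℝ) (v : EuclideanSpace ℝ d) :
    carlemanGain β (fun w => g (Q w)) v = carlemanGain β g (Q v) := by
  rw [carlemanGain, carlemanGain]
  symm
  rw [← (Q.measurePreserving).integral_comp (measurableEmbedding_isometry Q)]
  refine integral_congr_ae (Eventually.of_forall fun u => ?_)
  simp only [map_add, carlemanKernel_isometry]

/-- Integrability of the Carleman integrand is isometry invariant. [folklore] -/
theorem integrable_carlemanKernel_comp_isometry_iff (β : ℝ) (g : EuclideanSpace ℝ d → ℝ) (v : EuclideanSpace ℝ d) :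
    Integrable (fun u => carlemanKernel β v u * g (Q (v + u))) ↔
      Integrable (fun w => carlemanKernel β (Q v) w * g (Q v + w)) := by
  have h := (Q.measurePreserving).integrable_comp_emb (measurableEmbedding_isometry Q)
    (g := fun w => carlemanKernel β (Q v) w * g (Q v + w))
  rw [← h]
  refine integrable_congr (Eventually.of_forall fun u => ?_)
  simp only [Function.comp_apply, map_add, carlemanKernel_isometry]

/-- Finite energy is isometry invariant. [folklore] -/
theorem FiniteEnergy.comp_isometry (hd : 2 ≤ Fintype.card d) {g : EuclideanSpace ℝ d → ℝ} (hg : FiniteEnergy β g) :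
    FiniteEnergy β (fun w => g (Q w)) := by
  refine ⟨hg.measurable.comp Q.continuous.measurable, ?_⟩
  have h := ((Q.measurePreserving).integrable_comp_emb (measurableEmbedding_isometry Q)).2 hg.integrable
  refine h.congr (Eventually.of_forall fun w => ?_)
  simp only [Function.comp_apply]
  rw [collisionFrequency_isometry Q hd, maxwellianBeta_isometry]

/-- A.e. statements transfer along an isometry. [folklore] -/
theorem ae_comp_isometry {p : EuclideanSpace ℝ d → Prop} (h : ∀ᵐ w : EuclideanSpace ℝ d, p w) :
    ∀ᵐ v : EuclideanSpace ℝ d, p (Q v) :=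
  (Q.measurePreserving).quasiMeasurePreserving.tendsto_ae.eventually h

end Isometry

/-! ## The corrector equation in Carleman form, and its isometry invariance -/

section CorrectorIsometry

variable (hd : 2 ≤ Fintype.card d) (hβ : 0 < β)

/-- The components of a corrector have finite energy. [folklore] -/
theorem IsDiffusionCorrector.finiteEnergy_apply (hβ : 0 < β) {b : EuclideanSpace ℝ d → EuclideanSpace ℝ d}
    (hb : IsDiffusionCorrector β b) (i : d) : FiniteEnergy β (fun v => b v i) :=
  ⟨(EuclideanSpace.proj (𝕜 := ℝ) i).continuous.measurable.comp hb.1, hb.integrable_sq_apply hβ i⟩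

include hd hβ in
/-- **The corrector equation in Carleman form**: `a_β bᵢ - K bᵢ = vᵢ` a.e.
[cite: BodineauGallagherSaintRaymondInvent2016, (6.5)] -/
theorem IsDiffusionCorrector.ae_sub_carlemanGain_eq {b : EuclideanSpace ℝ d → EuclideanSpace ℝ d}
    (hb : IsDiffusionCorrector β b) (i : d) :
    ∀ᵐ v : EuclideanSpace ℝ d, collisionFrequency β v * b v i - carlemanGain β (fun w => b w i) v = v i := by
  have hfe := hb.finiteEnergy_apply hβ i
  filter_upwards [hb.2.2.2, ae_integrable_carlemanKernel_mul hd hβ hfe.measurable hfe.integrable] with v hv hint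
  rw [← linearBoltzmannGain_eq_carlemanGain hd hβ hfe.measurable v hint,
    ← linearBoltzmannOp_eq_sub hd hβ hfe.measurable v hint]
  exact hv i

include hd hβ in
/-- **A corrector from the Carleman form of the equation.** [folklore] -/
theorem isDiffusionCorrector_of_ae {b : EuclideanSpace ℝ d → EuclideanSpace ℝ d} (hbm : Measurable b)
    (hbi : Integrable fun v => ‖b v‖ ^ 2 * collisionFrequency β v * maxwellianBeta β v)
    (hbc : ∫ v, maxwellianBeta β v • b v = 0)
    (hL : ∀ i, ∀ᵐ v : EuclideanSpace ℝ d,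
      collisionFrequency β v * b v i - carlemanGain β (fun w => b w i) v = v i) :
    IsDiffusionCorrector β b := by
  refine ⟨hbm, hbi, hbc, ?_⟩
  have hfe : ∀ i, FiniteEnergy β (fun v => b v i) := fun i => by
    refine ⟨(EuclideanSpace.proj (𝕜 := ℝ) i).continuous.measurable.comp hbm, ?_⟩
    refine hbi.mono' ?_ (Eventually.of_forall fun v => ?_)
    · exact (((((EuclideanSpace.proj (𝕜 := ℝ) i).continuous.measurable.comp hbm).pow_const 2).mul
        (continuous_collisionFrequency hβ).measurable).mul (KineticTheory.measurable_maxwellianBeta β)).aestronglyMeasurable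
    · have hM := (maxwellianBeta_pos hβ v).le
      have ha := TaggedLinearBoltzmannSeries.collisionFrequency_nonneg hβ v
      rw [Real.norm_of_nonneg (mul_nonneg (mul_nonneg (sq_nonneg _) ha) hM)]
      exact mul_le_mul_of_nonneg_right (mul_le_mul_of_nonneg_right (sq_apply_le_norm_sq (b v) i) ha) hM
  refine ae_all_iff.2 fun i => ?_
  filter_upwards [hL i, ae_integrable_carlemanKernel_mul hd hβ (hfe i).measurable (hfe i).integrable] with v hv hint
  rw [linearBoltzmannOp_eq_sub hd hβ (hfe i).measurable v hint,
    linearBoltzmannGain_eq_carlemanGain hd hβ (hfe i).measurable v hint]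
  exact hv

/-- Coordinates of a linear map in the standard basis:
`(A y)ᵢ = ∑ⱼ (A eⱼ)ᵢ yⱼ`. [folklore] -/
theorem apply_isometry_eq_sum [DecidableEq d] (A : EuclideanSpace ℝ d ≃ₗᵢ[ℝ] EuclideanSpace ℝ d)
    (y : EuclideanSpace ℝ d) (i : d) :
    A y i = ∑ j, A (EuclideanSpace.single j (1 : ℝ)) i * y j := by
  have hy : y = ∑ j, y j • EuclideanSpace.single j (1 : ℝ) := by
    conv_lhs => rw [← (EuclideanSpace.basisFun d ℝ).sum_repr y]
    simp only [EuclideanSpace.basisFun_repr, EuclideanSpace.basisFun_apply]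
  conv_lhs => rw [hy]
  rw [map_sum]
  rw [WithLp.ofLp_sum, Finset.sum_apply]
  refine Finset.sum_congr rfl fun j _ => ?_
  rw [map_smul, WithLp.ofLp_smul, Pi.smul_apply, smul_eq_mul, mul_comm]

variable (Q : EuclideanSpace ℝ d ≃ₗᵢ[ℝ] EuclideanSpace ℝ d)

include hd hβ in
/-- **Correctors are isometry covariant**: if `b` is a corrector then so is `Q⁻¹ ∘ b ∘ Q`
(`L` commutes with `Q`). [folklore] -/
theorem IsDiffusionCorrector.comp_isometry {b : EuclideanSpace ℝ d → EuclideanSpace ℝ d}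
    (hb : IsDiffusionCorrector β b) : IsDiffusionCorrector β (fun v => Q.symm (b (Q v))) := by
  obtain ⟨hbm, hbi, hbc, -⟩ := id hb
  have hmp := Q.measurePreserving
  have hemb := measurableEmbedding_isometry Q
  refine isDiffusionCorrector_of_ae hd hβ ?_ ?_ ?_ ?_
  · exact Q.symm.continuous.measurable.comp (hbm.comp Q.continuous.measurable)
  · have h := (hmp.integrable_comp_emb hemb).2 hbi
    refine h.congr (Eventually.of_forall fun v => ?_)
    simp only [Function.comp_apply]
    rw [LinearIsometryEquiv.norm_map, collisionFrequency_isometry Q hd, maxwellianBeta_isometry]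
  · have h1 : (fun v => maxwellianBeta β v • Q.symm (b (Q v))) =
        fun v => Q.symm.toContinuousLinearEquiv ((fun w => maxwellianBeta β w • b w) (Q v)) := by
      funext v
      simp only [LinearIsometryEquiv.coe_toContinuousLinearEquiv, map_smul, maxwellianBeta_isometry]
    rw [h1, ContinuousLinearEquiv.integral_comp_comm,
      hmp.integral_comp hemb (fun w => maxwellianBeta β w • b w), hbc, map_zero]
  · classical
    intro i
    -- coordinates of `Q⁻¹`
    have hexp : ∀ y : EuclideanSpace ℝ d, Q.symm y i = ∑ j, Q.symm (EuclideanSpace.single j (1 : ℝ)) i * y j :=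
      fun y => apply_isometry_eq_sum Q.symm y i
    have hfe : ∀ j, FiniteEnergy β (fun w => b (Q w) j) := fun j =>
      (hb.finiteEnergy_apply hβ j).comp_isometry Q hd
    have hint1 : ∀ j, ∀ᵐ v : EuclideanSpace ℝ d,
        Integrable fun u => carlemanKernel β v u * b (Q (v + u)) j := by
      intro j
      -- (elaborated without expected type: the unifier must not guess `g` from the goal)
      have h := ae_integrable_carlemanKernel_mul hd hβ (hfe j).measurable (hfe j).integrable
      exact h
    have hint : ∀ᵐ v : EuclideanSpace ℝ d, ∀ j,
        Integrable fun u => carlemanKernel β v u * b (Q (v + u)) j := ae_all_iff.2 hint1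
    have heq1 : ∀ j, ∀ᵐ w : EuclideanSpace ℝ d,
        collisionFrequency β w * b w j - carlemanGain β (fun w => b w j) w = w j := fun j =>
      hb.ae_sub_carlemanGain_eq hd hβ j
    have heq0 : ∀ᵐ w : EuclideanSpace ℝ d, ∀ j,
        collisionFrequency β w * b w j - carlemanGain β (fun w => b w j) w = w j := ae_all_iff.2 heq1
    have heq : ∀ᵐ v : EuclideanSpace ℝ d, ∀ j,
        collisionFrequency β (Q v) * b (Q v) j - carlemanGain β (fun w => b w j) (Q v) = (Q v) j :=
      ae_comp_isometry Q (p := fun w => ∀ j,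
        collisionFrequency β w * b w j - carlemanGain β (fun w => b w j) w = w j) heq0
    filter_upwards [hint, heq] with v hv hw
    have hK : carlemanGain β (fun w => Q.symm (b (Q w)) i) v =
        ∑ j, Q.symm (EuclideanSpace.single j (1 : ℝ)) i * carlemanGain β (fun w => b w j) (Q v) := by
      rw [carlemanGain]
      have h1 : (fun u => carlemanKernel β v u * Q.symm (b (Q (v + u))) i) =
          fun u => ∑ j, Q.symm (EuclideanSpace.single j (1 : ℝ)) i * (carlemanKernel β v u * b (Q (v + u)) j) := by
        funext u
        rw [hexp, Finset.mul_sum]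
        refine Finset.sum_congr rfl fun j _ => by ring
      rw [h1, integral_finsetSum _ fun j _ => (hv j).const_mul _]
      refine Finset.sum_congr rfl fun j _ => ?_
      rw [integral_const_mul, ← carlemanGain_comp_isometry Q β (fun w => b w j) v, carlemanGain]
    rw [hK, hexp (b (Q v)), Finset.mul_sum, ← Finset.sum_sub_distrib]
    have h2 : ∀ j, collisionFrequency β v * (Q.symm (EuclideanSpace.single j (1 : ℝ)) i * b (Q v) j) -
        Q.symm (EuclideanSpace.single j (1 : ℝ)) i * carlemanGain β (fun w => b w j) (Q v) =
        Q.symm (EuclideanSpace.single j (1 : ℝ)) i * (Q v) j := fun j => by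
      rw [← hw j, collisionFrequency_isometry Q hd]; ring
    simp_rw [h2]
    rw [← hexp (Q v), LinearIsometryEquiv.symm_apply_apply]

end CorrectorIsometry

/-! ## The diffusion matrix `Aᵢⱼ = ∫ vᵢ bⱼ M_β` is scalar -/

section Isotropy

variable (hd : 2 ≤ Fintype.card d) (hβ : 0 < β)

include hd hβ in
/-- `vᵢ bⱼ M_β` is integrable. [folklore] -/
theorem IsDiffusionCorrector.integrable_coord_mul_apply {b : EuclideanSpace ℝ d → EuclideanSpace ℝ d}
    (hb : IsDiffusionCorrector β b) (i j : d) :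
    Integrable fun v : EuclideanSpace ℝ d => v i * b v j * maxwellianBeta β v := by
  have h1 := integrable_sq_apply_mul_maxwellianBeta (d := d) hβ i
  have h2 := integrable_sq_mul_maxwellianBeta_of_finiteEnergy hd hβ (hb.finiteEnergy_apply hβ j)
  refine ((h1.add h2).div_const 2).mono' ?_ (Eventually.of_forall fun v => ?_)
  · exact (((EuclideanSpace.proj (𝕜 := ℝ) i).continuous.measurable.mul
      ((EuclideanSpace.proj (𝕜 := ℝ) j).continuous.measurable.comp hb.1)).mul
      (KineticTheory.measurable_maxwellianBeta β)).aestronglyMeasurable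
  · have hM := (maxwellianBeta_pos hβ v).le
    rw [Real.norm_eq_abs, abs_mul, abs_of_nonneg hM, abs_mul]
    simp only [Pi.add_apply]
    rw [le_div_iff₀ two_pos]
    nlinarith [mul_nonneg (mul_self_nonneg (|v i| - |b v j|)) hM, sq_abs (v i), sq_abs (b v j)]

include hd hβ in
/-- Uniqueness of the corrector in integrated form: `∫ vᵢ (Q⁻¹ b (Q v))ⱼ M_β = ∫ vᵢ bⱼ M_β`. [folklore] -/
theorem IsDiffusionCorrector.integral_coord_mul_comp_isometry {b : EuclideanSpace ℝ d → EuclideanSpace ℝ d}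
    (hb : IsDiffusionCorrector β b) (Q : EuclideanSpace ℝ d ≃ₗᵢ[ℝ] EuclideanSpace ℝ d) (i j : d) :
    ∫ v, v i * Q.symm (b (Q v)) j * maxwellianBeta β v = ∫ v, v i * b v j * maxwellianBeta β v := by
  refine integral_congr_ae ?_
  filter_upwards [isDiffusionCorrector_unique hd hβ (hb.comp_isometry hd hβ Q) hb] with v hv
  rw [hv]

section Flip

variable [DecidableEq d]

/-- The sign flip of the `m`-th coordinate, a linear isometry of `ℝ^d`. [folklore] -/
def coordFlip (m : d) : EuclideanSpace ℝ d ≃ₗᵢ[ℝ] EuclideanSpace ℝ d :=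
  LinearIsometryEquiv.piLpCongrRight 2 fun j => if j = m then LinearIsometryEquiv.neg ℝ else LinearIsometryEquiv.refl ℝ ℝ

/-- Coordinates of the sign flip. [folklore] -/
theorem coordFlip_apply (m : d) (v : EuclideanSpace ℝ d) (j : d) :
    coordFlip m v j = (if j = m then -1 else 1) * v j := by
  simp only [coordFlip, LinearIsometryEquiv.piLpCongrRight_apply, PiLp.toLp_apply]
  split_ifs <;> simp

/-- The sign flip is an involution. [folklore] -/
theorem coordFlip_coordFlip (m : d) (v : EuclideanSpace ℝ d) : coordFlip m (coordFlip m v) = v := by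
  ext j
  rw [coordFlip_apply, coordFlip_apply]
  split_ifs <;> ring

/-- The sign flip is its own inverse. [folklore] -/
theorem coordFlip_symm_apply (m : d) (v : EuclideanSpace ℝ d) : (coordFlip m).symm v = coordFlip m v := by
  conv_lhs => rw [← coordFlip_coordFlip m v]
  rw [LinearIsometryEquiv.symm_apply_apply]

end Flip

/-- The transposition of the coordinates `m` and `n`, a linear isometry of `ℝ^d`. [folklore] -/
def coordSwap [DecidableEq d] (m n : d) : EuclideanSpace ℝ d ≃ₗᵢ[ℝ] EuclideanSpace ℝ d :=
  LinearIsometryEquiv.piLpCongrLeft 2 ℝ ℝ (Equiv.swap m n)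

/-- Coordinates of the transposition. [folklore] -/
theorem coordSwap_apply [DecidableEq d] (m n : d) (v : EuclideanSpace ℝ d) (j : d) :
    coordSwap m n v j = v (Equiv.swap m n j) := by
  simp only [coordSwap, LinearIsometryEquiv.piLpCongrLeft_apply, Equiv.piCongrLeft'_apply, Equiv.symm_swap]

/-- The transposition is an involution. [folklore] -/
theorem coordSwap_coordSwap [DecidableEq d] (m n : d) (v : EuclideanSpace ℝ d) : coordSwap m n (coordSwap m n v) = v := by
  ext j
  rw [coordSwap_apply, coordSwap_apply, Equiv.swap_apply_self]

/-- The transposition is its own inverse. [folklore] -/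
theorem coordSwap_symm_apply [DecidableEq d] (m n : d) (v : EuclideanSpace ℝ d) :
    (coordSwap m n).symm v = coordSwap m n v := by
  conv_lhs => rw [← coordSwap_coordSwap m n v]
  rw [LinearIsometryEquiv.symm_apply_apply]

include hd hβ in
/-- **Off-diagonal entries vanish**: `∫ vᵢ bⱼ M_β = 0` for `i ≠ j` (flip the sign of `vᵢ`).
[cite: BodineauGallagherSaintRaymondInvent2016, (6.8)] -/
theorem IsDiffusionCorrector.integral_coord_mul_coord_of_ne {b : EuclideanSpace ℝ d → EuclideanSpace ℝ d}
    (hb : IsDiffusionCorrector β b) {i j : d} (hij : i ≠ j) :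
    ∫ v, v i * b v j * maxwellianBeta β v = 0 := by
  classical
  set S := coordFlip (d := d) i with hS
  have h := hb.integral_coord_mul_comp_isometry hd hβ S i j
  -- compute the left-hand side by the change of variables `v = S w`
  have hlhs : ∫ v, v i * S.symm (b (S v)) j * maxwellianBeta β v = -∫ v, v i * b v j * maxwellianBeta β v := by
    rw [← (S.measurePreserving).integral_comp (measurableEmbedding_isometry S), ← integral_neg]
    refine integral_congr_ae (Eventually.of_forall fun w => ?_)
    simp only
    rw [coordFlip_symm_apply, hS, coordFlip_coordFlip, coordFlip_apply, coordFlip_apply, maxwellianBeta_isometry]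
    simp [hij.symm]
  rw [hlhs] at h
  linarith

include hd hβ in
/-- **Diagonal entries coincide**: `∫ v_m b_m M_β = ∫ v_n b_n M_β` (swap the coordinates). [folklore] -/
theorem IsDiffusionCorrector.integral_coord_mul_coord_diag {b : EuclideanSpace ℝ d → EuclideanSpace ℝ d}
    (hb : IsDiffusionCorrector β b) (m n : d) :
    ∫ v, v m * b v m * maxwellianBeta β v = ∫ v, v n * b v n * maxwellianBeta β v := by
  classical
  set P := coordSwap (d := d) m n with hP
  have h := hb.integral_coord_mul_comp_isometry hd hβ P m m
  have hlhs : ∫ v, v m * P.symm (b (P v)) m * maxwellianBeta β v = ∫ v, v n * b v n * maxwellianBeta β v := by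
    rw [← (P.measurePreserving).integral_comp (measurableEmbedding_isometry P)]
    refine integral_congr_ae (Eventually.of_forall fun w => ?_)
    simp only
    rw [coordSwap_symm_apply, hP, coordSwap_coordSwap, coordSwap_apply, coordSwap_apply, maxwellianBeta_isometry,
      Equiv.swap_apply_left]
  rw [hlhs] at h
  exact h.symm

include hd hβ in
/-- **The diagonal entries are `κ_β`**: `∫ vᵢ bᵢ M_β = κ_β = d⁻¹ ∫ v · b M_β`.
[cite: BodineauGallagherSaintRaymondInvent2016, (6.8)] -/
theorem IsDiffusionCorrector.integral_coord_mul_coord_self {b : EuclideanSpace ℝ d → EuclideanSpace ℝ d}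
    (hb : IsDiffusionCorrector β b) (i : d) :
    ∫ v, v i * b v i * maxwellianBeta β v = bgsrDiffusionCoeff β b := by
  have hcard : (0 : ℝ) < Fintype.card d := by exact_mod_cast (show 0 < Fintype.card d by omega)
  rw [bgsrDiffusionCoeff]
  have hsum : ∫ v, ⟪v, b v⟫_ℝ * maxwellianBeta β v = ∑ j : d, ∫ v, v j * b v j * maxwellianBeta β v := by
    rw [← integral_finsetSum _ fun j _ => hb.integrable_coord_mul_apply hd hβ j j]
    refine integral_congr_ae (Eventually.of_forall fun v => ?_)
    show ⟪v, b v⟫_ℝ * maxwellianBeta β v = ∑ j, v j * b v j * maxwellianBeta β v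
    rw [inner_eq_sum_apply, Finset.sum_mul]
  rw [hsum, Finset.sum_congr rfl fun j _ => hb.integral_coord_mul_coord_diag hd hβ j i, Finset.sum_const,
    Finset.card_univ, nsmul_eq_mul, ← mul_assoc, inv_mul_cancel₀ hcard.ne', one_mul]

include hd hβ in
/-- **Isotropy of the diffusion matrix**: `∫ (k·v)(k·b(v)) M_β(v) dv = κ_β |k|²` for every
`k ∈ ℝ^d`. [cite: BodineauGallagherSaintRaymondInvent2016, (6.8)] -/
theorem IsDiffusionCorrector.integral_inner_mul_inner {b : EuclideanSpace ℝ d → EuclideanSpace ℝ d}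
    (hb : IsDiffusionCorrector β b) (k : EuclideanSpace ℝ d) :
    ∫ v, ⟪k, v⟫_ℝ * ⟪k, b v⟫_ℝ * maxwellianBeta β v = bgsrDiffusionCoeff β b * ‖k‖ ^ 2 := by
  classical
  have hint := hb.integrable_coord_mul_apply hd hβ
  have h1 : (fun v => ⟪k, v⟫_ℝ * ⟪k, b v⟫_ℝ * maxwellianBeta β v) =
      fun v => ∑ i, ∑ j, k i * k j * (v i * b v j * maxwellianBeta β v) := by
    funext v
    rw [inner_eq_sum_apply, inner_eq_sum_apply, Finset.sum_mul, Finset.sum_mul]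
    refine Finset.sum_congr rfl fun i _ => ?_
    rw [Finset.mul_sum, Finset.sum_mul]
    refine Finset.sum_congr rfl fun j _ => by ring
  rw [h1, integral_finsetSum _ fun i _ => integrable_finsetSum Finset.univ fun j _ => (hint i j).const_mul (k i * k j)]
  have h2 : ∀ i, ∫ v, ∑ j, k i * k j * (v i * b v j * maxwellianBeta β v) = k i * k i * bgsrDiffusionCoeff β b := by
    intro i
    rw [integral_finsetSum _ fun j _ => (hint i j).const_mul (k i * k j)]
    rw [Finset.sum_eq_single i]
    · rw [integral_const_mul, hb.integral_coord_mul_coord_self hd hβ i]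
    · intro j _ hji
      rw [integral_const_mul, hb.integral_coord_mul_coord_of_ne hd hβ (Ne.symm hji), mul_zero]
    · intro hi; exact absurd (Finset.mem_univ i) hi
  simp_rw [h2]
  rw [← Finset.sum_mul, mul_comm, EuclideanSpace.norm_sq_eq]
  congr 1
  refine Finset.sum_congr rfl fun i _ => ?_
  rw [Real.norm_eq_abs, sq_abs, sq]

end Isotropy

end Literature.MathematicalPhysics.KineticTheory
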